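import Summits.FinalStateConjecture.FinalStateConjecture.Theorems.SoloBlindFocal
import Summits.FinalStateConjecture.FinalStateConjecture.Theorems.SoloBlindLateLeaves

/-!
# Solo (blind) — Theorem B‴ in kernel form: curvature spikes above late achronal flat leaves

Second kernel layer of Theorem B‴ of `paper/rigidity-appendix.md` §H.6 (soloist
`solo-FinalStateConjecture-blind`). The landed causal skeleton `soloBlind_focal_contradiction`
(`Theorems/SoloBlindFocal.lean`) took as a hypothesis the SEPARATION of the focal event's
neighbourhood `B` from the flat chart's late image; `Theorems/SoloBlindLateLeaves.lean` derives
that separation from a Kretschmann lower bound on `B` and the `C²`-convergence of the flat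
leaves. Here the two are combined into the packaged input `SoloBlindFocalCurvatureInput 𝒟`,
whose clauses are now exactly the paper's remaining analytic statements:

* Step 0 (from (H3)): exhaustive decompositions of the self-determined exterior have `N = 0`;
* for every holeless exhaustive decomposition and every chart time `τ₁`: a focal event `x` on a
  future-complete normalised null ray from the data ((H1*) completeness + Prop. 3 / (A″b): the
  spike), an open `B ∋ x` on which `|K₁| > 1` (the spike has `K₁ ≥ 2`), and a flat leaf
  `Ψ₀({x⁰ = τ₂} ∩ U₀)` with `τ₂ ≥ τ₁`, `τ₂ > τ₀`, which is achronal and has `x` in its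
  chronological future (Step 3: Theorem R″ + horizontality + drift, App. H.5, and (H4)).

`soloBlind_focalCurvatureInput_imp` : this implies `SoloBlindFocalInput 𝒟` (choose `τ₁` by
`soloBlind_exists_disjoint_flat_lateRegion_of_lt_abs_kretschmannAt` with `κ = 1`), whence
`soloBlind_focalCurvature_not_settles` and `soloBlind_focalCurvature_not_P` (the typed property
`P` of `FinalStateConjecture` fails for the datum) by the landed corollaries.

References: B. O'Neill, *Semi-Riemannian geometry*, 1983, Ch. 14 (pp. 402–404, 413);
B. Kotschwar, §1.1 (8) [Kotschwar2014]; D. Christodoulou, CQG 16 (1999) A23, pp. A26–A27.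
-/

noncomputable section

open Literature.Geometry.Lorentzian Set Filter
open scoped Manifold ContDiff Topology

set_option linter.dupNamespace false

namespace Summit.FinalStateConjecture.FinalStateConjecture.Theorems

variable {X : Type} [TopologicalSpace X] [ChartedSpace E3 X] [IsManifold (𝓡 3) ∞ X]
  [ConnectedSpace X] {D : InitialDataSet (𝓡 3) X}

/-- **The analytic input of Theorem B‴, curvature form.** (i) Step 0: exhaustive final state
decompositions of the self-determined exterior of `𝒟` have no holes; (ii) for every holeless
exhaustive decomposition and every chart time `τ₁` there are a focal event `x` on a
future-complete normalised null ray from the data, an open `B ∋ x` on which the Kretschmann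
scalar has `|K₁| > 1`, and a flat leaf at a chart time `τ₂ ≥ τ₁`, `τ₂ > τ₀`, which is achronal
with `x ∈ I⁺(leaf)`. `paper/rigidity-appendix.md`, Theorem B‴ (Steps 0, 2, 3 and (A″b)). -/
def SoloBlindFocalCurvatureInput (𝒟 : CauchyDevelopment D) [𝒟.metric.HasLeviCivita] : Prop :=
  (∀ (O : Set 𝒟.carrier) (d : FinalStateDecomposition 𝒟.toSpacetime O 2),
    O = exteriorOf 𝒟 d.charted → HasExhaustiveCharts d → d.N = 0) ∧
  ∀ (O : Set 𝒟.carrier) (d : FinalStateDecomposition 𝒟.toSpacetime O 2), d.N = 0 →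
    O = exteriorOf 𝒟 d.charted → HasExhaustiveCharts d → ∀ τ₁ : ℝ,
      ∃ (x : 𝒟.carrier) (p : X) (γ : ℝ → 𝒟.carrier) (dom : Set ℝ) (t : ℝ),
        𝒟.metric.IsNormalisedNullRayFrom 𝒟.timeOrientation 𝒟.embed 𝒟.normal p γ dom ∧
        ¬ BddAbove dom ∧ t ∈ dom ∧ 0 ≤ t ∧ γ t = x ∧
        ∃ (B : Set 𝒟.carrier) (τ₂ : ℝ), IsOpen B ∧ x ∈ B ∧
          (∀ q ∈ B, 1 < |𝒟.toSpacetime.kretschmannAt q|) ∧ d.τ₀ < τ₂ ∧ τ₁ ≤ τ₂ ∧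
          𝒟.metric.IsAchronal 𝒟.timeOrientation
            (d.flatChart '' (Minkowski.backgroundOn d.flatDomain).timeSlab τ₂) ∧
          x ∈ 𝒟.metric.chronologicalFuture 𝒟.timeOrientation
            (d.flatChart '' (Minkowski.backgroundOn d.flatDomain).timeSlab τ₂)

/-- **Curvature form implies the separated form.** Step 1 of Theorem B‴: choose `τ₁` so large
that every set with `|K₁| > 1` misses the flat late image after `τ₁`
(`soloBlind_exists_disjoint_flat_lateRegion_of_lt_abs_kretschmannAt`), then read off the
separated focal input. `paper/rigidity-appendix.md`, §H.6, Step 1. [cite: Kotschwar2014] -/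
theorem soloBlind_focalCurvatureInput_imp (𝒟 : CauchyDevelopment D) [𝒟.metric.HasLeviCivita]
    (H : SoloBlindFocalCurvatureInput 𝒟) : SoloBlindFocalInput 𝒟 := by
  refine ⟨H.1, fun O d hN hO hex ↦ ?_⟩
  obtain ⟨τ₁, hτ₁⟩ :=
    soloBlind_exists_disjoint_flat_lateRegion_of_lt_abs_kretschmannAt d le_rfl one_pos
  obtain ⟨x, p, γ, dom, t, hγ, hdom, ht, h0, hx, B, τ₂, hB, hxB, hK, h02, h12, hA, hxI⟩ :=
    H.2 O d hN hO hex τ₁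
  exact ⟨x, p, γ, dom, t, hγ, hdom, ht, h0, hx, B, τ₁, τ₂, hB, hxB, h02, h12,
    hτ₁ τ₁ le_rfl B hK, hA, hxI⟩

/-- **Theorem B‴ (kernel form of its logic).** Under the curvature-form focal input, `𝒟`
carries no `C²` final state decomposition of its self-determined exterior with rays staying in
the closure and exhaustive charts. `paper/rigidity-appendix.md`, Theorem B‴. -/
theorem soloBlind_focalCurvature_not_settles (𝒟 : CauchyDevelopment D)
    [𝒟.metric.HasLeviCivita] (H : SoloBlindFocalCurvatureInput 𝒟) :
    ¬ ∃ (O : Set 𝒟.carrier) (d : FinalStateDecomposition 𝒟.toSpacetime O 2),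
        (∀ i, Kerr.IsSubextremal (d.mass i) (d.spin i)) ∧ O = exteriorOf 𝒟 d.charted ∧
          RaysStayInClosure 𝒟 O ∧ HasExhaustiveCharts d ∧ IsFutureOriented d :=
  soloBlind_focal_not_settles 𝒟 (soloBlind_focalCurvatureInput_imp 𝒟 H)

/-- **Corollary (`¬ P(D₁″)` of Theorem B‴).** If some maximal vacuum Cauchy development of `D`
satisfies the curvature-form focal input, the property asserted of generic data by
`FinalStateConjecture` fails for `D`. `paper/rigidity-appendix.md`, Theorem B‴. -/
theorem soloBlind_focalCurvature_not_P (𝒟 : VacuumCauchyDevelopment D) (hmax : 𝒟.IsMaximal)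
    [𝒟.metric.HasLeviCivita] (H : SoloBlindFocalCurvatureInput 𝒟.toCauchyDevelopment) :
    ¬ ((∃ 𝒟' : VacuumCauchyDevelopment D, 𝒟'.IsMaximal) ∧
        ∀ 𝒟' : VacuumCauchyDevelopment D, 𝒟'.IsMaximal →
          HasCompleteNullInfinity 𝒟'.toCauchyDevelopment ∧
            ∃ (O : Set 𝒟'.carrier) (d : FinalStateDecomposition 𝒟'.toSpacetime O 2),
              (∀ i, Kerr.IsSubextremal (d.mass i) (d.spin i)) ∧
                O = exteriorOf 𝒟'.toCauchyDevelopment d.charted ∧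
                  RaysStayInClosure 𝒟'.toCauchyDevelopment O ∧
                    HasExhaustiveCharts d ∧ IsFutureOriented d) :=
  soloBlind_focal_not_P 𝒟 hmax (soloBlind_focalCurvatureInput_imp 𝒟.toCauchyDevelopment H)

end Summit.FinalStateConjecture.FinalStateConjecture.Theorems

end
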